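import Mathlib.CategoryTheory.Galois.Basic
import Mathlib.CategoryTheory.Limits.Preserves.Finite
import Mathlib.CategoryTheory.Limits.Constructions.EpiMono
import Mathlib.CategoryTheory.Limits.Types.Coproducts

/-!
# Exact functors between Galois categories are fundamental functors (proofs)

Proof-only file (no definitions).  A *morphism of connected anabelioids* `φ : X → Y` is by
definition an exact functor `φ^* : Y ⥤ X` ([GeoAn] Def. 1.1.2 (i); tree: `Anabelioids.Hom`), and
the dictionary of `Anabelioids/Basic.lean` uses throughout that such a functor "induces a
homomorphism of fundamental groups", i.e. that for a basepoint (fibre functor) `β` of `X` the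
composite `φ^* ⋙ β` is a basepoint of `Y`.  This is the content of [SGA1, Exp. V, Prop. 6.1]
("`u` exact `⇔` `F' ∘ u` is a fibre functor"); we prove the direction used by the tree:

* `fiberFunctor_comp_of_exact`: if `P : Y ⥤ X` preserves finite limits and finite colimits
  (`X`, `Y` Galois categories) and `F` is a fibre functor of `X`, then `P ⋙ F` is a fibre functor
  of `Y`;
* `reflectsIsomorphisms_of_exact`: such a `P` reflects isomorphisms (is conservative);
* `not_isInitial_obj_of_exact`: such a `P` sends non-initial objects to non-initial objects.

The one non-formal point is conservativity.  No image factorisation is needed: if `f` is not an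
isomorphism then either `f` is a monomorphism with non-initial complement `Z` (axiom (G3)), and
`P` preserves the decomposition `B ≅ A ⨿ Z` with `P Z` non-initial, or `f` is not a monomorphism,
and the same argument applies to the (split mono, non-iso) diagonal `A ⟶ A ×_B A`.
-/

namespace Literature.AnabelianGeometry.Anabelioids

open CategoryTheory CategoryTheory.Limits CategoryTheory.PreGaloisCategory

universe w v₁ v₂ u₁ u₂

variable {X : Type u₁} [Category.{v₁} X] [GaloisCategory X]
  {Y : Type u₂} [Category.{v₂} Y] [GaloisCategory Y]
  (P : Y ⥤ X) [PreservesFiniteLimits P] [PreservesFiniteColimits P]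

omit [GaloisCategory Y] in
/-- The fibres of the two legs of a binary coproduct diagram are embedded injectively, disjointly,
and cover (local copy of `fiber_binaryCofan` of `GaloisFullSubcategory.lean`, to keep this file
Mathlib-only). [folklore] -/
private theorem fiber_binaryCofan' (F : X ⥤ FintypeCat.{w}) [FiberFunctor F] {A B C : X}
    (m : A ⟶ C) (u : B ⟶ C) (hc : IsColimit (BinaryCofan.mk m u)) :
    Function.Injective (F.map m) ∧ Function.Injective (F.map u) ∧
      IsCompl (Set.range (F.map m)) (Set.range (F.map u)) := by
  exact (Types.binaryCofan_isColimit_iff _).mp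
    ⟨mapIsColimitOfPreservesOfIsColimit (F ⋙ FintypeCat.incl) m u hc⟩

/-- In a Galois category, a non-initial object maps epimorphically onto the terminal object (its
fibre is nonempty and the fibre of `⊤` is a point). [cite: SGA1, Exp. V §4 (condition (G5))] -/
theorem epi_terminal_from_of_not_isInitial {A : Y} (hA : IsInitial A → False) :
    Epi (terminal.from A) := by
  let F := GaloisCategory.getFiberFunctor Y
  obtain ⟨a⟩ := (not_initial_iff_fiber_nonempty F A).mp hA
  have hT : IsTerminal (F.obj (⊤_ Y)) := isLimitOfHasTerminalOfPreservesLimit F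
  have hsub : Subsingleton (F.obj (⊤_ Y)) := by
    refine ⟨fun x y => ?_⟩
    have h := hT.hom_ext (FintypeCat.homMk fun _ : F.obj (⊤_ Y) => x)
      (FintypeCat.homMk fun _ : F.obj (⊤_ Y) => y)
    simpa using ConcreteCategory.congr_hom h x
  have hsurj : Function.Surjective (F.map (terminal.from A)) :=
    fun t => ⟨a, hsub.elim _ _⟩
  have : Epi (F.map (terminal.from A)) := ConcreteCategory.epi_of_surjective _ hsurj
  exact F.epi_of_epi_map this

/-- An exact functor between Galois categories sends non-initial objects to non-initial objects.
[cite: SGA1, Exp. V Prop. 6.1] -/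
theorem not_isInitial_obj_of_exact {A : Y} (hA : IsInitial A → False) :
    IsInitial (P.obj A) → False := by
  intro hPA
  let F := GaloisCategory.getFiberFunctor X
  have hepi : Epi (terminal.from A) := epi_terminal_from_of_not_isInitial hA
  have hepi' : Epi (P.map (terminal.from A)) := P.map_epi _
  -- the fibre of `P A` is empty, that of `P ⊤ ≅ ⊤` is a point: no surjection
  have hsurj := surjective_on_fiber_of_epi F (P.map (terminal.from A))
  have hempty : IsEmpty (F.obj (P.obj A)) := (initial_iff_fiber_empty F (P.obj A)).mp ⟨hPA⟩
  have hT : IsTerminal ((P ⋙ F).obj (⊤_ Y)) := isLimitOfHasTerminalOfPreservesLimit (P ⋙ F)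
  have hne : Nonempty (F.obj (P.obj (⊤_ Y))) := by
    by_contra h
    rw [not_nonempty_iff] at h
    -- an empty terminal finite set is impossible: the map from a point would have no image
    exact h.false ((hT.from (FintypeCat.of PUnit.{v₁ + 1})) PUnit.unit)
  obtain ⟨t⟩ := hne
  obtain ⟨a, -⟩ := hsurj t
  exact hempty.false a

omit [GaloisCategory Y] in
/-- In a Galois category, a monomorphism which is not an isomorphism has a non-initial complement.
[cite: SGA1, Exp. V §4 (condition (G3))] -/
theorem complement_not_isInitial_of_mono_of_not_isIso {A B Z : Y} (i : A ⟶ B) [Mono i]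
    (u : Z ⟶ B) (hc : IsColimit (BinaryCofan.mk i u)) (hi : ¬ IsIso i) :
    IsInitial Z → False := fun hZ =>
  hi ((BinaryCofan.isColimit_iff_isIso_inl hZ (BinaryCofan.mk i u)).mp ⟨hc⟩)

/-- If a coproduct decomposition `B ≅ A ⨿ Z` in a Galois category has `A ⟶ B` an isomorphism, then
`Z` is initial (fibres: `F(B) = F(A) ⊔ F(Z)`). [cite: SGA1, Exp. V §4 (condition (G5))] -/
theorem isInitial_complement_of_isIso {A B Z : X} (i : A ⟶ B) (u : Z ⟶ B)
    (hc : IsColimit (BinaryCofan.mk i u)) [IsIso i] : Nonempty (IsInitial Z) := by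
  let F := GaloisCategory.getFiberFunctor X
  obtain ⟨-, hu, hcompl⟩ := fiber_binaryCofan' F i u hc
  rw [initial_iff_fiber_empty F]
  refine ⟨fun z => ?_⟩
  have hsurj : Function.Surjective (F.map i) := fun b =>
    ⟨F.map (inv i) b, by rw [← FintypeCat.comp_apply, ← F.map_comp, IsIso.inv_hom_id, F.map_id]; rfl⟩
  obtain ⟨a, ha⟩ := hsurj (F.map u z)
  have hmem : F.map u z ∈ Set.range (F.map i) ⊓ Set.range (F.map u) := ⟨⟨a, ha⟩, ⟨z, rfl⟩⟩
  rw [hcompl.inf_eq_bot] at hmem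
  exact hmem

/-- **Exact functors between Galois categories reflect isomorphisms** (are conservative).
[cite: SGA1, Exp. V Prop. 6.1] -/
theorem reflectsIsomorphisms_of_exact : P.ReflectsIsomorphisms := by
  refine ⟨fun {A B} f hPf => ?_⟩
  by_contra hf
  -- Step 1: reduce to a monomorphism `i` (either `f` itself or the diagonal of `f`) which is not
  -- an isomorphism but whose image under `P` is an isomorphism.
  have key : ∀ {A' B' : Y} (i : A' ⟶ B') [Mono i], ¬ IsIso i → IsIso (P.map i) → False := by
    intro A' B' i _ hi hPi
    obtain ⟨Z, u, ⟨hc⟩⟩ := PreGaloisCategory.monoInducesIsoOnDirectSummand i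
    have hZ := complement_not_isInitial_of_mono_of_not_isIso i u hc hi
    have hPc : IsColimit (BinaryCofan.mk (P.map i) (P.map u)) :=
      mapIsColimitOfPreservesOfIsColimit P i u hc
    obtain ⟨hPZ⟩ := isInitial_complement_of_isIso (P.map i) (P.map u) hPc
    exact not_isInitial_obj_of_exact P hZ hPZ
  by_cases hm : Mono f
  · exact key f hf hPf
  · -- the diagonal `δ : A ⟶ A ×_B A` is a split monomorphism, not an isomorphism
    let δ : A ⟶ pullback f f := pullback.lift (𝟙 A) (𝟙 A) rfl
    have hδfst : δ ≫ pullback.fst f f = 𝟙 A := pullback.lift_fst _ _ _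
    haveI : IsSplitMono δ := IsSplitMono.mk' ⟨pullback.fst f f, hδfst⟩
    have hδ : ¬ IsIso δ := by
      intro hδiso
      apply hm
      have : IsIso (pullback.fst f f) := by
        have : pullback.fst f f = inv δ := by
          rw [← cancel_epi δ, hδfst, IsIso.hom_inv_id]
        rw [this]
        infer_instance
      exact (pullback.diagonal_isKernelPair f).mono_of_isIso_fst
    -- `P δ` is an isomorphism: `P` preserves the pullback and `P f` is a monomorphism
    have hPfst : IsIso (P.map (pullback.fst f f)) := by
      rw [← PreservesPullback.iso_hom_fst P f f]
      infer_instance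
    have hPδ : IsIso (P.map δ) := by
      have h1 : P.map δ ≫ P.map (pullback.fst f f) = 𝟙 _ := by
        rw [← P.map_comp, hδfst, P.map_id]
      have : P.map δ = inv (P.map (pullback.fst f f)) := by
        rw [← cancel_mono (P.map (pullback.fst f f)), h1, IsIso.inv_hom_id]
      rw [this]
      infer_instance
    exact key δ hδ hPδ

/-- **An exact functor between Galois categories followed by a fibre functor is a fibre functor**
([SGA1, Exp. V, Prop. 6.1]; this is why a morphism of connected anabelioids `φ : X → Y`,
i.e. an exact `φ^* : Y ⥤ X`, carries basepoints of `X` to basepoints of `Y`, [GeoAn] Def. 1.1.2).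
[cite: SGA1, Exp. V Prop. 6.1] -/
theorem fiberFunctor_comp_of_exact (F : X ⥤ FintypeCat.{w}) [FiberFunctor F] :
    FiberFunctor (P ⋙ F) := by
  haveI := reflectsIsomorphisms_of_exact P
  exact {
    preservesTerminalObjects := inferInstance
    preservesPullbacks := inferInstance
    preservesFiniteCoproducts := ⟨fun n => inferInstance⟩
    preservesEpis := inferInstance
    preservesQuotientsByFiniteGroups := fun G _ _ => by
      obtain ⟨G', hg, hf, ⟨e⟩⟩ := Finite.exists_type_univ_nonempty_mulEquiv.{v₂, 0} G
      have : PreservesColimitsOfShape (SingleObj G') P := inferInstance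
      have : PreservesColimitsOfShape (SingleObj G) P :=
        preservesColimitsOfShape_of_equiv e.toSingleObjEquiv.symm P
      infer_instance
    reflectsIsos := inferInstance }

end Literature.AnabelianGeometry.Anabelioids
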